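import Summits.CriticalPhenomena.CardyFormulaZ2.Theorems.CardyBoundaryCoulombGasBoundaryDefectGaussianRStubRigidityOfLocalLawsPart3
import Summits.CriticalPhenomena.CardyFormulaZ2.Theorems.CardyBoundaryCoulombGasBoundaryDefectGaussianRStubRigidityOfLocalLawsPart4
import Summits.CriticalPhenomena.CardyFormulaZ2.Theorems.CardyBoundaryCoulombGasBoundaryDefectGaussianRStubRigidityOfLocalLawsPart6
import Summits.CriticalPhenomena.CardyFormulaZ2.Theorems.CardyBoundaryCoulombGasBoundaryDefectGaussianRStubReferenceLimitPart3

/-!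
# Stub `stub_rigidity_of_local_laws` of line `rainbow-monomials-in-excursion-kernels` — Part 7:
# admissibility is preserved by unit slides along flat stretches

Crux `BoundaryDefectGaussianR` (stmt-CriticalPhenomena-14132). The combinatorial heart of the
TRANSPORT hypothesis of `s3_rigidityOfTransport` (Part 4), settled geometry-free on an arbitrary
finite `V ⊂ ℤ²` for `Literature.Probability.LatticeModels.CollarLegModel`:

* `s3_admissible_of_dist` — **index-free admissibility criterion**: a source, positive legs, sink
  not a source, the sink's exterior dart `d₀`, every insertion point a vertex of `V` with exactly one
  outside neighbour MET BY `cycle V d₀`, and pairwise `ℓ∞`-separation `≥ G ≥ sinkLegs` ⇒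
  `IsAdmissible` (indices recovered from the unique exterior darts, gaps from `s3_dsucc_iterate_dist`,
  then `s3_admissible_of`);
* `s3_admissible_transfer` — **unit slides keep admissibility**: if `ι` is admissible on `V` and
  every insertion point of `ι'` is an insertion point of `ι` or the flat-stretch neighbour
  `x ± dir (kk+1)` of one (both missing the neighbour in direction `kk`, the new point having exactly
  one outside neighbour), and `ι'` has a source, positive legs, sink not a source, `sinkLegs ≤ G` and
  `ℓ∞`-separation `≥ G`, then `ι'` is admissible — for a source this is `dsucc`/its inverse on the
  cycle (`s3_dsucc_cases`, `s3_cycle_orbit`), for THE SINK the cycle from the new sink dart is the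
  old one rotated (`s3_cycle_orbit`, last clause).

* `s3_admissible_slide` — the rainbow-datum form used by the stubs: for an injective configuration
  `p : Fin k → ℤ²` with admissible `ι(p) = ⟨(univ.erase j).image p, v ↦ Σ_{b≠j, p b = v} L b, p j⟩`,
  the slide `update p i (p i + τ)`, `τ = ±dir (kk+1)`, of a source or of the sink along its flat
  stretch (both points miss the neighbour in direction `kk`, the new one has exactly one outside
  neighbour), still injective and `ℓ∞`-separated by `≥ G ≥ Σ_{b≠j} L b`, has an admissible rainbow
  datum (the elementary `rainbow_*` facts of stub 4's Part 3 feed `s3_admissible_transfer`).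
Corner jumps use `s3_admissible_of_dist` directly, following `dsucc` around the lattice corner.
-/

noncomputable section

namespace Summit.CriticalPhenomena.CardyFormulaZ2.Cruxes.BoundaryDefectGaussianR.RainbowMonomialsInExcursionKernels

open Literature.Probability.LatticeModels Literature.Probability.LatticeModels.CollarLegModel

/-- **Admissibility from separation (index-free criterion).** Leg-insertion data on a finite
`V ⊂ ℤ²` is admissible as soon as: there is a source, legs are positive, the sink is not a source,
the sink has an exterior dart `d₀`, every insertion point is a vertex of `V` with exactly one outside
neighbour MET BY THE BOUNDARY CYCLE through `d₀` (some dart of `cycle V d₀` sits at it), and the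
insertion points are pairwise at `ℓ∞`-distance at least `G ≥ sinkLegs`. (The indices of
`s3_admissible_of` are recovered from the unique exterior darts; their gaps dominate the
`ℓ∞`-distances by `s3_dsucc_iterate_dist`.) This is the criterion used along transport paths:
"met by the cycle" is transported by `s3_dsucc_cases` / `s3_cycle_orbit`, separation is geometric. [folklore] -/
theorem s3_admissible_of_dist :
    ∀ (ι : Literature.Probability.LatticeModels.CollarLegModel.LegInsertionData) (V : Finset (ℤ × ℤ))
    (d₀ : Literature.Probability.LatticeModels.CollarLegModel.Dart) (G : ℕ),
    ι.source.Nonempty → (∀ x ∈ ι.source, 1 ≤ ι.legs x) → ι.sink ∉ ι.source →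
    Literature.Probability.LatticeModels.CollarLegModel.outDart V ι.sink = some d₀ →
    (∀ x ∈ insert ι.sink ι.source, x ∈ V ∧
      ((Literature.Probability.LatticeModels.CollarLegModel.neighbours x).filter (fun y ↦ y ∉ V)).card = 1 ∧
      ∃ e ∈ Literature.Probability.LatticeModels.CollarLegModel.cycle V d₀, e.1 = x) →
    ι.sinkLegs ≤ G →
    (∀ x ∈ insert ι.sink ι.source, ∀ x' ∈ insert ι.sink ι.source, x ≠ x' →
      (G : ℤ) ≤ max |x.1 - x'.1| |x.2 - x'.2|) →
    ι.IsAdmissible V := by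
  intro ι V d₀ G hne hlegs hsink hout hpos hG hsep
  classical
  obtain ⟨hd₀1, hd₀t⟩ := s3_outDart_some V ι.sink d₀ hout
  have hsinkV : ι.sink ∈ V := (hpos ι.sink (Finset.mem_insert_self _ _)).1
  have hv₀ : d₀.1 ∈ V := hd₀1 ▸ hsinkV
  have ht₀ : dartTip d₀ ∉ V := by rw [dartTip, hd₀1]; exact hd₀t
  obtain ⟨hP0, -, hret, hmin⟩ := s3_period_spec V d₀ hv₀ ht₀
  obtain ⟨hmem, -, -, -, -, -⟩ := s3_cycle_orbit V d₀ hv₀ ht₀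
  -- every insertion point has its exterior dart on the cycle
  have hidx : ∀ x ∈ insert ι.sink ι.source, ∃ s, s < period V d₀ ∧
      outDart V x = some ((dsucc V)^[s] d₀) := by
    intro x hx
    obtain ⟨-, hcard, e, he, hex⟩ := hpos x hx
    obtain ⟨s, hs, rfl⟩ := (hmem _).1 he
    obtain ⟨hev, het⟩ := (s3_dsucc_iterate V s).1 d₀ hv₀ ht₀
    obtain ⟨kx, houtx, -, huniq⟩ := s3_outDart_of_card V x hcard
    refine ⟨s, hs, ?_⟩
    rw [houtx]
    congr 1
    have hk' : ((dsucc V)^[s] d₀).2 = kx := by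
      apply huniq
      rw [← hex]
      exact het
    rw [← hex, ← hk']
  choose! m hm using hidx
  have hvert : ∀ x ∈ insert ι.sink ι.source, ((dsucc V)^[m x] d₀).1 = x := fun x hx ↦
    (s3_outDart_some V x _ (hm x hx).2).1
  -- index gaps dominate `ℓ∞`-distances
  have hgapdist : ∀ x ∈ insert ι.sink ι.source, ∀ g : ℕ,
      max |(((dsucc V)^[g] ((dsucc V)^[m x] d₀)).1).1 - x.1| |(((dsucc V)^[g] ((dsucc V)^[m x] d₀)).1).2 - x.2|
        ≤ g := by
    intro x hx g
    have := s3_dsucc_iterate_dist V ((dsucc V)^[m x] d₀) g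
    rw [hvert x hx] at this
    exact max_le this.1 this.2
  refine s3_admissible_of ι V d₀ m G hne hlegs hsink hout (fun x hx ↦ ⟨(hpos x hx).1, (hpos x hx).2.1⟩)
    hG hm ?_ ?_
  · -- pairwise gaps
    intro x hx x' hx' hlt
    have hne' : x' ≠ x := by
      intro h; subst h; exact lt_irrefl _ hlt
    have h1 := hsep x' hx' x hx hne'
    have h2 := hgapdist x hx (m x' - m x)
    rw [← Function.iterate_add_apply, Nat.sub_add_cancel hlt.le, hvert x' hx'] at h2
    have : (G : ℤ) ≤ ((m x' - m x : ℕ) : ℤ) := h1.trans h2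
    omega
  · -- gap to the end of the cycle
    intro x hx
    by_cases hxs : x = ι.sink
    · -- the sink sits at index `0`, and another point fits before the end
      subst hxs
      have hm0 : m ι.sink = 0 := by
        by_contra h0
        refine hmin (m ι.sink) (Nat.pos_of_ne_zero h0) (hm _ hx).1 ?_
        have := (hm _ hx).2
        rw [hout] at this
        exact (Option.some.inj this).symm
      obtain ⟨x₁, hx₁⟩ := hne
      have hx₁' : x₁ ∈ insert ι.sink ι.source := Finset.mem_insert_of_mem hx₁
      have hne₁ : ι.sink ≠ x₁ := fun h ↦ hsink (h ▸ hx₁)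
      have h1 := hsep _ hx _ hx₁' hne₁
      -- from `x₁` to the end: vertex of `f^[P] d₀ = d₀` is the sink
      have h2 := hgapdist x₁ hx₁' (period V d₀ - m x₁)
      rw [← Function.iterate_add_apply, Nat.sub_add_cancel (hm _ hx₁').1.le, hret, hd₀1] at h2
      have h3 : (G : ℤ) ≤ ((period V d₀ - m x₁ : ℕ) : ℤ) := h1.trans h2
      rw [hm0]
      omega
    · have h1 := hsep _ (Finset.mem_insert_self _ _) x hx (Ne.symm hxs)
      have h2 := hgapdist x hx (period V d₀ - m x)
      rw [← Function.iterate_add_apply, Nat.sub_add_cancel (hm _ hx).1.le, hret, hd₀1] at h2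
      have : (G : ℤ) ≤ ((period V d₀ - m x : ℕ) : ℤ) := h1.trans h2
      have hlt := (hm _ hx).1
      omega

/-- **Transfer of admissibility along unit slides (re-anchoring).** Let `ι` be admissible on `V`
and let `ι'` be leg-insertion data on the same `V` (a source, positive legs, sink not a source,
`sinkLegs ≤ G`, points pairwise `ℓ∞`-separated by `≥ G`) each of whose insertion points is EITHER an
insertion point of `ι` OR a vertex `y ∈ V` with exactly one outside neighbour that is the
NEIGHBOUR ALONG A FLAT STRETCH of an insertion point `x` of `ι`: for some direction `kk`, both
`x + dir kk ∉ V` and `y + dir kk ∉ V`, and `y = x + dir (kk+1)` or `x = y + dir (kk+1)`. Then `ι'`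
is admissible. (Covers the unit slide of a source or of THE SINK — the cycle from the new sink dart
is the old cycle rotated — and any simultaneous such moves; corner jumps instead use
`s3_admissible_of_dist` directly, following `dsucc` around the lattice corner.) [folklore] -/
theorem s3_admissible_transfer :
    ∀ (ι ι' : Literature.Probability.LatticeModels.CollarLegModel.LegInsertionData) (V : Finset (ℤ × ℤ))
    (G : ℕ), ι.IsAdmissible V →
    ι'.source.Nonempty → (∀ x ∈ ι'.source, 1 ≤ ι'.legs x) → ι'.sink ∉ ι'.source → ι'.sinkLegs ≤ G →
    (∀ x ∈ insert ι'.sink ι'.source, ∀ x' ∈ insert ι'.sink ι'.source, x ≠ x' →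
      (G : ℤ) ≤ max |x.1 - x'.1| |x.2 - x'.2|) →
    (∀ y ∈ insert ι'.sink ι'.source, y ∈ insert ι.sink ι.source ∨
      (y ∈ V ∧ ((Literature.Probability.LatticeModels.CollarLegModel.neighbours y).filter
        (fun z ↦ z ∉ V)).card = 1 ∧
      ∃ x ∈ insert ι.sink ι.source, ∃ kk : Fin 4,
        x + Literature.Probability.LatticeModels.CollarLegModel.dir kk ∉ V ∧
        y + Literature.Probability.LatticeModels.CollarLegModel.dir kk ∉ V ∧
        (y = x + Literature.Probability.LatticeModels.CollarLegModel.dir (kk + 1) ∨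
          x = y + Literature.Probability.LatticeModels.CollarLegModel.dir (kk + 1)))) →
    ι'.IsAdmissible V := by
  intro ι ι' V G hadm hne hlegs hsink hG hsep hpts
  obtain ⟨d₀, hout, hd₀1, hv₀, ht₀, hold⟩ := s3_of_admissible ι V hadm
  obtain ⟨hmem, -, hall, -, hclosed, hrot⟩ := s3_cycle_orbit V d₀ hv₀ ht₀
  -- every old insertion point is met by the cycle through `d₀`, at its unique exterior dart
  have holdmet : ∀ x ∈ insert ι.sink ι.source, x ∈ V ∧
      ((neighbours x).filter (fun z ↦ z ∉ V)).card = 1 ∧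
      ∀ kk : Fin 4, x + dir kk ∉ V → ((x, kk) : Dart) ∈ cycle V d₀ := by
    intro x hx
    obtain ⟨hxV, hxc, m, -, hom⟩ := hold x hx
    refine ⟨hxV, hxc, fun kk hkk ↦ ?_⟩
    obtain ⟨he1, he2⟩ := s3_outDart_some V x _ hom
    obtain ⟨k₀, -, -, huniq⟩ := s3_outDart_of_card V x hxc
    have h1 : ((dsucc V)^[m] d₀).2 = k₀ := huniq _ he2
    have h2 : kk = k₀ := huniq _ hkk
    have : ((x, kk) : Dart) = (dsucc V)^[m] d₀ := by
      rw [← he1, h2, ← h1]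
    rw [this]
    exact hall m
  -- every new insertion point is met by the cycle through `d₀`
  have hmet : ∀ y ∈ insert ι'.sink ι'.source, y ∈ V ∧
      ((neighbours y).filter (fun z ↦ z ∉ V)).card = 1 ∧ ∃ e ∈ cycle V d₀, e.1 = y := by
    intro y hy
    rcases hpts y hy with hyold | ⟨hyV, hyc, x, hx, kk, hxk, hyk, hadj⟩
    · obtain ⟨hyV, hyc, hcyc⟩ := holdmet y hyold
      obtain ⟨k, -, hk, -⟩ := s3_outDart_of_card V y hyc
      exact ⟨hyV, hyc, (y, k), hcyc k hk, rfl⟩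
    · obtain ⟨hxV, -, hcyc⟩ := holdmet x hx
      have hxcyc := hcyc kk hxk
      refine ⟨hyV, hyc, (y, kk), ?_, rfl⟩
      rcases hadj with rfl | rfl
      · -- forward: `(y, kk) = dsucc V (x, kk)`
        have hds := (s3_dsucc_cases V x kk).2.1 hyV hyk
        rw [← hds]
        obtain ⟨m, -, hmx⟩ := (hmem _).1 hxcyc
        have : dsucc V (x, kk) = (dsucc V)^[m + 1] d₀ := by
          rw [Function.iterate_succ_apply', hmx]
        rw [this]
        exact hall _
      · -- backward: `dsucc V (y, kk) = (x, kk)` with `x = y + dir (kk+1)`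
        have hds := (s3_dsucc_cases V y kk).2.1 hxV hxk
        exact hclosed (y, kk) hyV hyk (hds ▸ hxcyc)
  -- the new sink's exterior dart lies on the old cycle, which is therefore its own cycle, rotated
  obtain ⟨hsV', hsc', e', he', he'1⟩ := hmet ι'.sink (Finset.mem_insert_self _ _)
  obtain ⟨k', hout', hk', huniq'⟩ := s3_outDart_of_card V ι'.sink hsc'
  obtain ⟨s, -, rfl⟩ := (hmem _).1 he'
  obtain ⟨-, het⟩ := (s3_dsucc_iterate V s).1 d₀ hv₀ ht₀
  have he'eq : (dsucc V)^[s] d₀ = ((ι'.sink, k') : Dart) := by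
    have h2 : ((dsucc V)^[s] d₀).2 = k' := huniq' _ (by rw [← he'1]; exact het)
    rw [← he'1, ← h2]
  obtain ⟨-, hsame⟩ := hrot ((ι'.sink, k') : Dart) (he'eq ▸ hall s)
  refine s3_admissible_of_dist ι' V (ι'.sink, k') G hne hlegs hsink hout' (fun y hy ↦ ?_) hG hsep
  obtain ⟨hyV, hyc, e, he, hey⟩ := hmet y hy
  exact ⟨hyV, hyc, e, (hsame e).2 he, hey⟩

/-- **The unit slide of one insertion point keeps the rainbow datum admissible.** For an injective
configuration `p : Fin k → ℤ²` with admissible rainbow datum `ι(p) = ⟨(univ.erase j).image p,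
v ↦ Σ_{b ≠ j, p b = v} L b, p j⟩` on `V`, slide the point `p i` (a source or THE SINK) by
`τ = ±dir (kk+1)` ALONG its flat stretch — `p i` and `p i + τ` both miss their neighbour in
direction `kk`, `p i + τ ∈ V` has exactly one outside neighbour — keeping the configuration
injective and `ℓ∞`-separated by at least `G ≥ Σ_{b ≠ j} L b`: the new rainbow datum is admissible.
(`s3_admissible_transfer` + the elementary `rainbow_*` facts of stub 4's Part 3.) [folklore] -/
theorem s3_admissible_slide :
    ∀ (k : ℕ) (L : Fin k → ℕ) (j : Fin k) (V : Finset (ℤ × ℤ)) (p : Fin k → ℤ × ℤ) (i : Fin k)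
    (τ : ℤ × ℤ) (kk : Fin 4) (G : ℕ), Function.Injective p →
    Function.Injective (Function.update p i (p i + τ)) →
    Literature.Probability.LatticeModels.CollarLegModel.LegInsertionData.IsAdmissible
      (⟨(Finset.univ.erase j).image p, fun v ↦ ∑ b ∈ (Finset.univ.erase j).filter (fun b ↦ p b = v), L b,
        p j⟩ : Literature.Probability.LatticeModels.CollarLegModel.LegInsertionData) V →
    (τ = Literature.Probability.LatticeModels.CollarLegModel.dir (kk + 1) ∨
      τ = -Literature.Probability.LatticeModels.CollarLegModel.dir (kk + 1)) →
    p i + Literature.Probability.LatticeModels.CollarLegModel.dir kk ∉ V → p i + τ ∈ V →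
    p i + τ + Literature.Probability.LatticeModels.CollarLegModel.dir kk ∉ V →
    ((Literature.Probability.LatticeModels.CollarLegModel.neighbours (p i + τ)).filter
      (fun z ↦ z ∉ V)).card = 1 →
    ∑ b ∈ Finset.univ.erase j, L b ≤ G →
    (∀ a b : Fin k, a ≠ b → (G : ℤ) ≤
      max |(Function.update p i (p i + τ) a).1 - (Function.update p i (p i + τ) b).1|
        |(Function.update p i (p i + τ) a).2 - (Function.update p i (p i + τ) b).2|) →
    Literature.Probability.LatticeModels.CollarLegModel.LegInsertionData.IsAdmissible
      (⟨(Finset.univ.erase j).image (Function.update p i (p i + τ)),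
        fun v ↦ ∑ b ∈ (Finset.univ.erase j).filter (fun b ↦ Function.update p i (p i + τ) b = v), L b,
        Function.update p i (p i + τ) j⟩ :
        Literature.Probability.LatticeModels.CollarLegModel.LegInsertionData) V := by
  intro k L j V p i τ kk G hp hp' hadm hτ hxk hyV hyk hyc hG hsep
  set p' := Function.update p i (p i + τ) with hp'def
  have hk : ∃ b, b ≠ j := by
    obtain ⟨⟨x, hx⟩, -⟩ := hadm
    obtain ⟨b, hb, -⟩ := Finset.mem_image.1 hx
    exact ⟨b, (Finset.mem_erase.1 hb).1⟩
  have hLpos : ∀ b, b ≠ j → 1 ≤ L b := by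
    intro b hb
    obtain ⟨-, hlegs, -⟩ := hadm
    have hm : b ∈ Finset.univ.erase j := Finset.mem_erase.2 ⟨hb, Finset.mem_univ _⟩
    have hsum : ∑ b' ∈ (Finset.univ.erase j).filter (fun b' ↦ p b' = p b), L b' = L b :=
      Finset.sum_eq_single_of_mem b (Finset.mem_filter.2 ⟨hm, rfl⟩)
        (fun b' hb' hne ↦ absurd (hp (Finset.mem_filter.1 hb').2) hne)
    have := hlegs (p b) (Finset.mem_image_of_mem p hm)
    simp only at this
    rwa [hsum] at this
  refine s3_admissible_transfer _ _ V G hadm (rainbow_source_nonempty j p' hk) (rainbow_legs_pos L j p' hLpos)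
    (rainbow_sink_not_mem j p' hp') ?_ ?_ ?_
  · -- `sinkLegs' = Σ_{b ≠ j} L b ≤ G`
    unfold LegInsertionData.sinkLegs
    simp only
    rw [Finset.sum_fiberwise_of_maps_to (fun b hb ↦ Finset.mem_image_of_mem p' hb)]
    exact hG
  · -- separation
    intro x hx x' hx' hne
    obtain ⟨a, rfl⟩ := rainbow_mem_insert j p' hx
    obtain ⟨b, rfl⟩ := rainbow_mem_insert j p' hx'
    exact hsep a b (fun h ↦ hne (h ▸ rfl))
  · -- every new point is an old point or the flat-stretch neighbour of `p i`
    intro y hy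
    obtain ⟨a, rfl⟩ := rainbow_mem_insert j p' hy
    have hold : ∀ c : Fin k, p c ∈ insert (p j) ((Finset.univ.erase j).image p) := by
      intro c
      by_cases hc : c = j
      · subst hc; exact Finset.mem_insert_self _ _
      · exact Finset.mem_insert_of_mem
          (Finset.mem_image_of_mem p (Finset.mem_erase.2 ⟨hc, Finset.mem_univ c⟩))
    by_cases hai : a = i
    · subst hai
      right
      have hpa : p' a = p a + τ := by simp [hp'def]
      rw [hpa]
      refine ⟨hyV, hyc, p a, hold a, kk, hxk, hyk, ?_⟩
      rcases hτ with rfl | rfl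
      · exact Or.inl rfl
      · exact Or.inr (by abel)
    · left
      have hpa : p' a = p a := by simp [hp'def, hai]
      rw [hpa]
      exact hold a

end Summit.CriticalPhenomena.CardyFormulaZ2.Cruxes.BoundaryDefectGaussianR.RainbowMonomialsInExcursionKernels

end
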